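import Summits.HodgeConjecture.CorCM.OcticWeilMultiHodgeOfMarkman
import Summits.HodgeConjecture.CorCM.OcticWeil13PairFamilyHodgeOfMarkman
import Mathlib.LinearAlgebra.Dimension.Constructions
import HarnessLib

/-!
# COR-CM — the octic INDEPENDENCE CRITERION: at most THREE types; automatic for ONE type and for up to THREE pairwise distinct
# `(1,3)`-types — every finite family of CM fourfolds over `K` of `k`-signature `(1,3)` whose types take at most three values, × `E^a`,
# GIVEN ONLY Markman's hyperbolic-sixfold theorem

Cell `pub-hodgecm2` (COR-CM), seat b30 gen 25 (2026-08-23); count-neutral own lane OCTIC-MULTI (geometry half).  Theorems only; no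
definition, no named fact of its own, no `sorry`.  HONEST FRAMING: the Hodge-conjecture statements are CONDITIONAL on the displayed
named facts `HodgeTheory.Markman2025_weilClasses_algebraic_hyperbolicSixfold` (arXiv:2502.03415 Thm 1.5.1) resp.
`…_abelianFourfold` (arXiv:2509.23403 Thm 1.2), both unrefereed; `HC_CM` is not asserted.  The four-pair twin of gen 24's
`CorCM/DecicWeil23MultiLeThreeHodgeOfMarkman.lean`.

* §0 **`IndepPosO.le_three`, `le_three_of_hIndO`** — the criterion bounds the number of types: `r ≤ 3` (an injective `ℤ`-linear map
  `ℤ^{r+1} → ℤ⁴`).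
* §1 **`hIndO_one`** — ONE type of `k`-signature `(1,3)` or `(2,2)` satisfies the criterion; **`hIndO_of_typeCount_one`** — up to THREE
  pairwise distinct `(1,3)`-types satisfy it (a `(1,3)`-type is determined by its `τ`-member, gen 21's
  `OcticWeil13Pair.eq_of_typeCount_one_of_meet`; a fourth embedding over `τ` lies in none of them).  Frame-free proofs.
* §2 **`hodgeConjectureFor_of_avDominatedBy_family₁_conj_of_markmanO`** — ONE type `Φ₁` (`(1,3)` or `(2,2)`): every finite family of CM
  fourfolds of type `Φ₁` or `Φ̄₁`, × `E^a`, everything dominated, mod the Markman theorem of its signature (gens 18/19 re-derived under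
  `2`-transitivity); **`hodgeConjectureFor_of_avDominatedBy_family₁₃_le₃_of_markmanSixfold`** — EVERY finite family `A_j ⊨ (K; Θ_j)` of CM
  fourfolds of `k`-signature `(1,3)` whose types take AT MOST THREE values (i.e. avoid one of the four `(1,3)`-types of `K ⊇ i(k)`),
  × `E^a`, everything dominated, GIVEN ONLY Markman's hyperbolic-sixfold theorem — NEW beyond gen 21's two types
  (`OcticWeil13Pair.hodgeConjectureFor_of_avDominatedBy_family₃_of_markmanSixfold`): the Hodge ring of `E × B'₁ × B'₂ × B'₃` is generated
  by divisors, three sixfold Weil classes `B'_l × E²` and the six eightfold Weil classes `B'_l × B̄'_m`.  (All four `(1,3)`-types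
  together are dependent — `𝟙_a + 𝟙_b + 𝟙_c + 𝟙_d = 𝟙`: the `(1,3)`-orbit carries classes outside the span, gen 19's census.)
[cite: Markman2025SecantWeil, Thm 1.5.1] [cite: Markman2025SurveySecant, Thm. 1.2] [cite: Shimura1998, §18.2 Lemma (i) and §6.1 Thm. 2 Cor.]
[cite: MoonenZarhin1995Duke, Thm. 2.4] [cite: MumfordAV1970, §19]

## References
* [Markman2025SecantWeil] E. Markman, arXiv:2502.03415 (unrefereed), Thm 1.5.1.  [Markman2025SurveySecant] E. Markman,
  arXiv:2509.23403 (unrefereed), Thm. 1.2.  [Shimura1998] G. Shimura, *Abelian varieties with CM and modular functions*, §18.2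
  Lemma (i), §6.1 Thm. 2 Cor.  [MoonenZarhin1995Duke] B. Moonen, Yu. Zarhin, Duke Math. J. 77 (1995), Thm. 2.4.  [MumfordAV1970]
  D. Mumford, *Abelian Varieties*, §19.
-/

noncomputable section

open CategoryTheory CategoryTheory.Limits NumberField

namespace Summit.HodgeConjecture.CorCM.OcticWeilMulti

open Literature.AlgebraicGeometry Literature.AlgebraicGeometry.Motives Literature.AlgebraicGeometry.HodgeTheory
open Literature.AlgebraicGeometry.ComplexMultiplication (IsCMTypeRealisation)
open Literature.AlgebraicTopology.SingularHomology
open Summit.HodgeConjecture.CorCM.Census.OcticWeilMulti (IndepPosO)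
open Summit.HodgeConjecture.CorCM.OcticCurveFourfold (card_filter_comp_eq_four)
open Summit.HodgeConjecture.CorCM.OcticWeil13Pair (eq_of_typeCount_one_of_meet)
open Summit.HodgeConjecture.CorCM.Domination (AVDominatedBy)

open scoped Classical

/-! ## §0 At most three types -/

section Bound

variable {r : ℕ}

/-- **The independence criterion allows at most THREE types**: `IndepPosO P` makes `(w, t) ↦ (x ↦ w + Σ_{m ∋ x} t_m)` an injective
`ℤ`-linear map `ℤ^{r+1} → ℤ⁴`, so `r + 1 ≤ 4`. [folklore] -/
theorem _root_.Summit.HodgeConjecture.CorCM.Census.OcticWeilMulti.IndepPosO.le_three {P : Fin r → Fin 4 → Bool}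
    (hind : IndepPosO P) : r ≤ 3 := by
  let L : (Fin (r + 1) → ℤ) →ₗ[ℤ] (Fin 4 → ℤ) :=
    { toFun := fun v x => v 0 + ∑ m : Fin r, (if P m x then v m.succ else 0)
      map_add' := fun v v' => by
        ext x
        simp only [Pi.add_apply]
        rw [Finset.sum_congr rfl fun m _ => show (if P m x then v m.succ + v' m.succ else 0) =
          (if P m x then v m.succ else 0) + (if P m x then v' m.succ else 0) by split_ifs <;> simp, Finset.sum_add_distrib]
        ring
      map_smul' := fun c v => by
        ext x
        simp only [Pi.smul_apply, smul_eq_mul, RingHom.id_apply]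
        rw [mul_add, Finset.mul_sum]
        congr 1
        exact Finset.sum_congr rfl fun m _ => by split_ifs <;> simp }
  have hL : Function.Injective L := by
    intro v v' h
    have key := hind (v 0 - v' 0) (fun m => v m.succ - v' m.succ) fun x => by
      have hx := congrFun h x
      simp only [L, LinearMap.coe_mk, AddHom.coe_mk] at hx
      rw [Finset.sum_congr rfl fun m _ => show (if P m x then v m.succ - v' m.succ else 0) =
        (if P m x then v m.succ else 0) - (if P m x then v' m.succ else 0) by split_ifs <;> simp, Finset.sum_sub_distrib]
      linarith
    ext j
    refine Fin.cases ?_ (fun m => ?_) j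
    · linarith [key.1]
    · linarith [key.2 m]
  have h := LinearMap.finrank_le_finrank_of_injective hL
  rw [Module.finrank_fin_fun, Module.finrank_fin_fun] at h
  omega

end Bound

/-! ## §1 The intrinsic criterion: one type; up to three `(1,3)`-types -/

section Intrinsic

variable {K : Type} [Field K] [NumberField K] {k : Type} [Field k] [NumberField k]

/-- **At most three types satisfy the intrinsic independence criterion**: if `hInd` holds for `Φ : Fin r → CMType K` then `r ≤ 3`
(read the types in a frame: `indepPosO_of_frame`, then `IndepPosO.le_three`). [folklore] -/
theorem le_three_of_hIndO {r : ℕ} (h8 : Module.finrank ℚ K = 8) (h2 : Module.finrank ℚ k = 2) (i : k →+* K) {τ : k →+* ℂ}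
    (hττ : ComplexEmbedding.conjugate τ ≠ τ) (hk : ∀ σ : k →+* ℂ, σ = τ ∨ σ = ComplexEmbedding.conjugate τ)
    (Φ : Fin r → CMType K)
    (hInd : ∀ (w : ℤ) (t : Fin r → ℤ), (∀ s : K →+* ℂ, s.comp i = τ → w + ∑ m : Fin r, (if s ∈ (Φ m).1 then t m else 0) = 0) →
      w = 0 ∧ ∀ m, t m = 0) : r ≤ 3 := by
  obtain ⟨e, P, he_sign, -, hP, -⟩ := exists_frameO h8 h2 i hττ hk Φ
  exact (indepPosO_of_frame he_sign hP hInd).le_three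

/-- **ONE type of `k`-signature `(1,3)` or `(2,2)` satisfies the independence criterion** (an embedding over `τ` off the type gives
`w = 0`, one in the type gives `t = 0`; frame-free). [folklore] -/
theorem hIndO_one (h8 : Module.finrank ℚ K = 8) (h2 : Module.finrank ℚ k = 2) (i : k →+* K) {τ : k →+* ℂ} (Φ₁ : CMType K)
    (hsig : (Finset.univ.filter fun s : K →+* ℂ => s.comp i = τ ∧ s ∈ Φ₁.1).card = 1 ∨
      (Finset.univ.filter fun s : K →+* ℂ => s.comp i = τ ∧ s ∈ Φ₁.1).card = 2) (w : ℤ) (t : Fin 1 → ℤ)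
    (h : ∀ s : K →+* ℂ, s.comp i = τ → w + ∑ m : Fin 1, (if s ∈ ((![Φ₁] : Fin 1 → CMType K) m).1 then t m else 0) = 0) :
    w = 0 ∧ ∀ m, t m = 0 := by
  have h' : ∀ s : K →+* ℂ, s.comp i = τ → w + (if s ∈ Φ₁.1 then t 0 else 0) = 0 := fun s hs => by
    have hx := h s hs
    rw [Fin.sum_univ_one] at hx
    exact hx
  have hF := card_filter_comp_eq_four i h8 h2 τ
  have hsplit := Finset.card_filter_add_card_filter_not (s := Finset.univ.filter fun s : K →+* ℂ => s.comp i = τ)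
    (fun s => s ∈ Φ₁.1)
  rw [Finset.filter_filter, Finset.filter_filter, hF] at hsplit
  -- an embedding over `τ` off `Φ₁`
  have hoff : 0 < (Finset.univ.filter fun s : K →+* ℂ => s.comp i = τ ∧ s ∉ Φ₁.1).card := by
    rcases hsig with hc | hc <;> rw [hc] at hsplit <;> omega
  obtain ⟨s₀, hs₀⟩ := Finset.card_pos.1 hoff
  obtain ⟨-, hs₀τ, hs₀Φ⟩ := Finset.mem_filter.1 hs₀
  have hw : w = 0 := by have := h' s₀ hs₀τ; rwa [if_neg hs₀Φ, add_zero] at this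
  -- an embedding over `τ` in `Φ₁`
  have hin : 0 < (Finset.univ.filter fun s : K →+* ℂ => s.comp i = τ ∧ s ∈ Φ₁.1).card := by
    rcases hsig with hc | hc <;> rw [hc] <;> norm_num
  obtain ⟨s₁, hs₁⟩ := Finset.card_pos.1 hin
  obtain ⟨-, hs₁τ, hs₁Φ⟩ := Finset.mem_filter.1 hs₁
  refine ⟨hw, fun m => ?_⟩
  rw [Fin.fin_one_eq_zero m]
  have := h' s₁ hs₁τ
  rwa [if_pos hs₁Φ, hw, zero_add] at this

/-- **UP TO THREE PAIRWISE DISTINCT `(1,3)`-TYPES satisfy the independence criterion** (frame-free).  A `(1,3)`-type is determined by its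
`τ`-member (`OcticWeil13Pair.eq_of_typeCount_one_of_meet`), so distinct types have distinct `τ`-members `s_m`; `r ≤ 3 < 4` leaves an
embedding over `τ` in none of the types (`w = 0`), and the equation at `s_m` reads `w + t_m = 0`. [cite: Shimura1998, §18.2 Lemma (i)] -/
theorem hIndO_of_typeCount_one {r : ℕ} (hr : r ≤ 3) (h8 : Module.finrank ℚ K = 8) (h2 : Module.finrank ℚ k = 2) (i : k →+* K)
    {τ : k →+* ℂ} (hττ : ComplexEmbedding.conjugate τ ≠ τ) (hk : ∀ σ : k →+* ℂ, σ = τ ∨ σ = ComplexEmbedding.conjugate τ)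
    (Φ : Fin r → CMType K) (h13 : ∀ m, (Finset.univ.filter fun s : K →+* ℂ => s.comp i = τ ∧ s ∈ (Φ m).1).card = 1)
    (hinj : Function.Injective Φ) (w : ℤ) (t : Fin r → ℤ)
    (h : ∀ s : K →+* ℂ, s.comp i = τ → w + ∑ m : Fin r, (if s ∈ (Φ m).1 then t m else 0) = 0) : w = 0 ∧ ∀ m, t m = 0 := by
  -- the `τ`-members
  have hmem : ∀ m : Fin r, ∃ sm : K →+* ℂ, sm.comp i = τ ∧ sm ∈ (Φ m).1 ∧ ∀ s : K →+* ℂ, s.comp i = τ → s ∈ (Φ m).1 → s = sm := by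
    intro m
    obtain ⟨sm, hsm⟩ := Finset.card_eq_one.1 (h13 m)
    have h1 : sm ∈ Finset.univ.filter fun s : K →+* ℂ => s.comp i = τ ∧ s ∈ (Φ m).1 := by
      rw [hsm]; exact Finset.mem_singleton_self _
    refine ⟨sm, (Finset.mem_filter.1 h1).2.1, (Finset.mem_filter.1 h1).2.2, fun s hs hs' => ?_⟩
    have hs'' : s ∈ Finset.univ.filter fun s : K →+* ℂ => s.comp i = τ ∧ s ∈ (Φ m).1 :=
      Finset.mem_filter.2 ⟨Finset.mem_univ _, hs, hs'⟩
    rw [hsm] at hs''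
    exact Finset.mem_singleton.1 hs''
  choose sm hsmτ hsmΦ hsmuniq using hmem
  -- distinct types have distinct `τ`-members
  have hsminj : ∀ m m' : Fin r, sm m ∈ (Φ m').1 → m = m' := by
    intro m m' hmm'
    apply hinj
    refine eq_of_typeCount_one_of_meet h8 h2 i hττ hk (h13 m) (h13 m') (le_antisymm ?_ ?_)
    · calc (Finset.univ.filter fun s : K →+* ℂ => s.comp i = τ ∧ (s ∈ (Φ m).1 ∧ s ∈ (Φ m').1)).card
          ≤ (Finset.univ.filter fun s : K →+* ℂ => s.comp i = τ ∧ s ∈ (Φ m).1).card :=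
            Finset.card_le_card fun s hs => by
              simp only [Finset.mem_filter, Finset.mem_univ, true_and] at hs ⊢
              exact ⟨hs.1, hs.2.1⟩
        _ = 1 := h13 m
    · exact Finset.card_pos.2 ⟨sm m, Finset.mem_filter.2 ⟨Finset.mem_univ _, hsmτ m, hsmΦ m, hmm'⟩⟩
  -- a further embedding over `τ`, in none of the types
  have hF := card_filter_comp_eq_four i h8 h2 τ
  obtain ⟨s₀, hs₀, hs₀'⟩ : ∃ s₀ ∈ Finset.univ.filter (fun s : K →+* ℂ => s.comp i = τ),
      s₀ ∉ (Finset.univ : Finset (Fin r)).image sm := by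
    by_contra hno
    push Not at hno
    have hle := Finset.card_le_card (show (Finset.univ.filter fun s : K →+* ℂ => s.comp i = τ) ⊆
      (Finset.univ : Finset (Fin r)).image sm from fun s hs => hno s hs)
    have h3 : ((Finset.univ : Finset (Fin r)).image sm).card ≤ 3 :=
      Finset.card_image_le.trans (by rw [Finset.card_univ, Fintype.card_fin]; exact hr)
    rw [hF] at hle
    omega
  have hs₀τ : s₀.comp i = τ := (Finset.mem_filter.1 hs₀).2
  have hs₀Φ : ∀ m, s₀ ∉ (Φ m).1 := fun m hm =>
    hs₀' (Finset.mem_image.2 ⟨m, Finset.mem_univ _, (hsmuniq m s₀ hs₀τ hm).symm⟩)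
  have hw : w = 0 := by
    have h0 := h s₀ hs₀τ
    rw [Finset.sum_eq_zero (fun m _ => if_neg (hs₀Φ m)), add_zero] at h0
    exact h0
  refine ⟨hw, fun m => ?_⟩
  have key := h (sm m) (hsmτ m)
  rw [hw, zero_add, Finset.sum_eq_single m (fun m' _ hm' => if_neg fun hmem' => hm' (hsminj m m' hmem').symm)
    (fun h' => absurd (Finset.mem_univ m) h'), if_pos (hsmΦ m)] at key
  exact key

end Intrinsic

/-! ## §2 Family corollaries -/

section Family

variable {K : Type} [Field K] [NumberField K] [IsCMField K] {k : Type} [Field k] [NumberField k] [IsCMField k]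
  {n : ℕ} {Θ : Fin n → CMType K} {A : Fin n → AbelianVariety ℂ} {ι : ∀ j, 𝓞 K →+* End (A j)}
  {θ : ∀ j, K →+* Module.End ℂ (complexBetti (A j).X 1)}
  {Ψ : CMType k} {E : AbelianVariety ℂ} {ιE : 𝓞 k →+* End E} {θE : k →+* Module.End ℂ (complexBetti E.X 1)}

/-- **ONE TYPE, up to conjugation.**  `K ⊇ i(k)` ANY octic CM field over the imaginary quadratic `k` with `Aut(ℂ)` `2`-transitive on the
four embeddings over `τ`; `Φ₁` a CM type of `K` of `k`-signature `(1,3)` or `(2,2)`; `A_j ⊨ (K; Θ_j)` CM fourfolds each of type `Φ₁`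
or `Φ̄₁`; `E ⊨ (k; Ψ ∋ τ)`: every `C` dominated by `E^a × ∏_j A_j` satisfies the Hodge conjecture, GIVEN ONLY Markman's theorem of the
signature of `Φ₁` (fourfold theorem for `(2,2)`, hyperbolic-sixfold theorem for `(1,3)`).  Gens 18/19's powers theorems re-derived from
the generic chain (there without the `2`-transitivity hypothesis). [cite: Markman2025SurveySecant, Thm. 1.2] [cite: Markman2025SecantWeil, Thm 1.5.1]
[cite: MumfordAV1970, §19] -/
theorem hodgeConjectureFor_of_avDominatedBy_family₁_conj_of_markmanO
    (h8 : Module.finrank ℚ K = 8) (h2 : Module.finrank ℚ k = 2) (i : k →+* K)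
    (hA : ∀ j, IsCMTypeRealisation (Θ j) (A j) (ι j) (θ j)) {τ : k →+* ℂ} (Φ₁ : CMType K)
    (hW4 : (Finset.univ.filter fun s : K →+* ℂ => s.comp i = τ ∧ s ∈ Φ₁.1).card = 2 →
      Markman2025_weilClasses_algebraic_abelianFourfold)
    (hM6 : (Finset.univ.filter fun s : K →+* ℂ => s.comp i = τ ∧ s ∈ Φ₁.1).card = 1 →
      Markman2025_weilClasses_algebraic_hyperbolicSixfold)
    (hsig : (Finset.univ.filter fun s : K →+* ℂ => s.comp i = τ ∧ s ∈ Φ₁.1).card = 1 ∨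
      (Finset.univ.filter fun s : K →+* ℂ => s.comp i = τ ∧ s ∈ Φ₁.1).card = 2)
    (hpos : ∀ j, Θ j = Φ₁ ∨ ∀ s : K →+* ℂ, s ∈ (Θ j).1 ↔ ComplexEmbedding.conjugate s ∈ Φ₁.1)
    (h2T : ∀ s t s' t' : K →+* ℂ, s.comp i = τ → t.comp i = τ → s'.comp i = τ → t'.comp i = τ → s ≠ t → s' ≠ t' →
      ∃ ρ : ℂ ≃+* ℂ, (ρ : ℂ →+* ℂ).comp s = s' ∧ (ρ : ℂ →+* ℂ).comp t = t')
    (hE : IsCMTypeRealisation Ψ E ιE θE) (hτΨ : τ ∈ Ψ.1) (a : ℕ)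
    {C : AbelianVariety ℂ} (hC : AVDominatedBy C ((⨁ fun _ : Fin a => E).prod (⨁ A))) :
    HodgeConjectureFor C.dim C.X :=
  hodgeConjectureFor_of_avDominatedBy_family_conj_of_markman_indepO h8 h2 i hA (![Φ₁] : Fin 1 → CMType K)
    (fun m hm => hW4 (by rw [Fin.fin_one_eq_zero m] at hm; exact hm))
    (fun m hm => hM6 (by rw [Fin.fin_one_eq_zero m] at hm; exact hm))
    (fun m => by rw [Fin.fin_one_eq_zero m]; exact hsig) (hIndO_one h8 h2 i Φ₁ hsig) (fun j => ⟨0, hpos j⟩) h2T hE hτΨ a hC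

/-- **`(1,3)`-types from an injective list of length `≤ 3`** (the engine of the next theorem). [cite: Markman2025SecantWeil, Thm 1.5.1]
[cite: Shimura1998, §6.1 Thm. 2 Cor.] -/
theorem hodgeConjectureFor_of_avDominatedBy_family₁₃_list_of_markmanSixfold {r : ℕ} (hr : r ≤ 3)
    (hM6 : Markman2025_weilClasses_algebraic_hyperbolicSixfold)
    (h8 : Module.finrank ℚ K = 8) (h2 : Module.finrank ℚ k = 2) (i : k →+* K)
    (hA : ∀ j, IsCMTypeRealisation (Θ j) (A j) (ι j) (θ j)) {τ : k →+* ℂ} (Φ : Fin r → CMType K)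
    (h13 : ∀ m, (Finset.univ.filter fun s : K →+* ℂ => s.comp i = τ ∧ s ∈ (Φ m).1).card = 1) (hinj : Function.Injective Φ)
    (hpos : ∀ j, ∃ m, Θ j = Φ m)
    (h2T : ∀ s t s' t' : K →+* ℂ, s.comp i = τ → t.comp i = τ → s'.comp i = τ → t'.comp i = τ → s ≠ t → s' ≠ t' →
      ∃ ρ : ℂ ≃+* ℂ, (ρ : ℂ →+* ℂ).comp s = s' ∧ (ρ : ℂ →+* ℂ).comp t = t')
    (hE : IsCMTypeRealisation Ψ E ιE θE) (hτΨ : τ ∈ Ψ.1) (a : ℕ)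
    {C : AbelianVariety ℂ} (hC : AVDominatedBy C ((⨁ fun _ : Fin a => E).prod (⨁ A))) :
    HodgeConjectureFor C.dim C.X := by
  have hττ : ComplexEmbedding.conjugate τ ≠ τ := QuarticCM.conjugate_ne τ
  have hk : ∀ σ : k →+* ℂ, σ = τ ∨ σ = ComplexEmbedding.conjugate τ := fun σ =>
    QuarticCM.eq_or_eq_conjugate_of_quadratic h2 τ σ
  exact hodgeConjectureFor_of_avDominatedBy_family_of_markman_indepO h8 h2 i hA Φ
    (fun m hm => by rw [h13 m] at hm; exact absurd hm (by norm_num)) (fun _ _ => hM6) (fun m => Or.inl (h13 m))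
    (hIndO_of_typeCount_one hr h8 h2 i hττ hk Φ h13 hinj) hpos h2T hE hτΨ a hC

/-- **THE `(1,3)` FAMILY FORM FOR AT MOST THREE VALUES.**  `K ⊇ i(k)` ANY octic CM field over the imaginary quadratic `k` with `Aut(ℂ)`
`2`-transitive on the four embeddings over `τ` (relative quartic with group `A₄`/`S₄`); `A_j ⊨ (K; Θ_j)` (`j < n`) CM abelian
fourfolds of `k`-signature `(1,3)` whose types all lie in `{Θ_{j₁}, Θ_{j₂}, Θ_{j₃}}` (coincidences allowed — i.e. the family avoids one
of the four `(1,3)`-types of `K ⊇ i(k)`); `E ⊨ (k; Ψ ∋ τ)`: every `C` dominated by `E^a × ∏_j A_j` satisfies the Hodge conjecture, GIVEN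
ONLY Markman's hyperbolic-sixfold theorem.  NEW for three values (the Hodge ring of `E × B'₁ × B'₂ × B'₃`: divisors, three sixfold and
six eightfold Weil classes); two values is gen 21's `OcticWeil13Pair.…family₃…`, one value gen 18.  All four values fail (the
`(1,3)`-orbit). [cite: Markman2025SecantWeil, Thm 1.5.1] [cite: Shimura1998, §6.1 Thm. 2 Cor.] [cite: MumfordAV1970, §19] -/
theorem hodgeConjectureFor_of_avDominatedBy_family₁₃_le₃_of_markmanSixfold
    (hM6 : Markman2025_weilClasses_algebraic_hyperbolicSixfold)
    (h8 : Module.finrank ℚ K = 8) (h2 : Module.finrank ℚ k = 2) (i : k →+* K)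
    (hA : ∀ j, IsCMTypeRealisation (Θ j) (A j) (ι j) (θ j)) {τ : k →+* ℂ} (j₁ j₂ j₃ : Fin n)
    (h13 : ∀ j, (Finset.univ.filter fun s : K →+* ℂ => s.comp i = τ ∧ s ∈ (Θ j).1).card = 1)
    (hpos : ∀ j, Θ j = Θ j₁ ∨ Θ j = Θ j₂ ∨ Θ j = Θ j₃)
    (h2T : ∀ s t s' t' : K →+* ℂ, s.comp i = τ → t.comp i = τ → s'.comp i = τ → t'.comp i = τ → s ≠ t → s' ≠ t' →
      ∃ ρ : ℂ ≃+* ℂ, (ρ : ℂ →+* ℂ).comp s = s' ∧ (ρ : ℂ →+* ℂ).comp t = t')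
    (hE : IsCMTypeRealisation Ψ E ιE θE) (hτΨ : τ ∈ Ψ.1) (a : ℕ)
    {C : AbelianVariety ℂ} (hC : AVDominatedBy C ((⨁ fun _ : Fin a => E).prod (⨁ A))) :
    HodgeConjectureFor C.dim C.X := by
  by_cases h₁₂ : Θ j₁ = Θ j₂
  · by_cases h₁₃ : Θ j₁ = Θ j₃
    · -- one value
      refine hodgeConjectureFor_of_avDominatedBy_family₁₃_list_of_markmanSixfold (by norm_num) hM6 h8 h2 i hA
        (![Θ j₁] : Fin 1 → CMType K) (fun m => by rw [Fin.fin_one_eq_zero m]; exact h13 j₁)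
        (fun x y _ => Subsingleton.elim x y) (fun j => ⟨0, ?_⟩) h2T hE hτΨ a hC
      rcases hpos j with h | h | h
      exacts [h, h.trans h₁₂.symm, h.trans h₁₃.symm]
    · -- two values `Θ j₁, Θ j₃`
      refine hodgeConjectureFor_of_avDominatedBy_family₁₃_list_of_markmanSixfold (by norm_num) hM6 h8 h2 i hA
        (![Θ j₁, Θ j₃] : Fin 2 → CMType K) (fun m => Fin.cases (h13 j₁) (fun m' => Fin.cases (h13 j₃) (fun l => l.elim0) m') m)
        (fun x y hxy => ?_) (fun j => ?_) h2T hE hτΨ a hC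
      · fin_cases x <;> fin_cases y
        · rfl
        · exact absurd hxy h₁₃
        · exact absurd hxy.symm h₁₃
        · rfl
      · rcases hpos j with h | h | h
        exacts [⟨0, h⟩, ⟨0, h.trans h₁₂.symm⟩, ⟨1, h⟩]
  · by_cases h₁₃ : Θ j₁ = Θ j₃
    · -- two values `Θ j₁, Θ j₂`
      refine hodgeConjectureFor_of_avDominatedBy_family₁₃_list_of_markmanSixfold (by norm_num) hM6 h8 h2 i hA
        (![Θ j₁, Θ j₂] : Fin 2 → CMType K) (fun m => Fin.cases (h13 j₁) (fun m' => Fin.cases (h13 j₂) (fun l => l.elim0) m') m)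
        (fun x y hxy => ?_) (fun j => ?_) h2T hE hτΨ a hC
      · fin_cases x <;> fin_cases y
        · rfl
        · exact absurd hxy h₁₂
        · exact absurd hxy.symm h₁₂
        · rfl
      · rcases hpos j with h | h | h
        exacts [⟨0, h⟩, ⟨1, h⟩, ⟨0, h.trans h₁₃.symm⟩]
    · by_cases h₂₃ : Θ j₂ = Θ j₃
      · -- two values `Θ j₁, Θ j₂ = Θ j₃`
        refine hodgeConjectureFor_of_avDominatedBy_family₁₃_list_of_markmanSixfold (by norm_num) hM6 h8 h2 i hA
          (![Θ j₁, Θ j₂] : Fin 2 → CMType K) (fun m => Fin.cases (h13 j₁) (fun m' => Fin.cases (h13 j₂) (fun l => l.elim0) m') m)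
          (fun x y hxy => ?_) (fun j => ?_) h2T hE hτΨ a hC
        · fin_cases x <;> fin_cases y
          · rfl
          · exact absurd hxy h₁₂
          · exact absurd hxy.symm h₁₂
          · rfl
        · rcases hpos j with h | h | h
          exacts [⟨0, h⟩, ⟨1, h⟩, ⟨1, h.trans h₂₃.symm⟩]
      · -- three pairwise distinct values
        refine hodgeConjectureFor_of_avDominatedBy_family₁₃_list_of_markmanSixfold le_rfl hM6 h8 h2 i hA
          (![Θ j₁, Θ j₂, Θ j₃] : Fin 3 → CMType K)
          (fun m => Fin.cases (h13 j₁) (fun m' => Fin.cases (h13 j₂) (fun m'' => Fin.cases (h13 j₃) (fun l => l.elim0) m'') m') m)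
          (fun x y hxy => ?_) (fun j => ?_) h2T hE hτΨ a hC
        · fin_cases x <;> fin_cases y
          · rfl
          · exact absurd hxy h₁₂
          · exact absurd hxy h₁₃
          · exact absurd hxy.symm h₁₂
          · rfl
          · exact absurd hxy h₂₃
          · exact absurd hxy.symm h₁₃
          · exact absurd hxy.symm h₂₃
          · rfl
        · rcases hpos j with h | h | h
          exacts [⟨0, h⟩, ⟨1, h⟩, ⟨2, h⟩]

/-- **In particular: the Hodge conjecture for `∏_j A_j`** — any finite product of CM abelian fourfolds over `K` of `k`-signature `(1,3)`
whose types take at most three values (e.g. `B'₁ × B'₂ × B'₃`, the carrier of the six eightfold Weil classes `B'_l × B̄'_m`), GIVEN ONLY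
Markman's hyperbolic-sixfold theorem. [cite: Markman2025SecantWeil, Thm 1.5.1] [cite: MumfordAV1970, §19] -/
theorem hodgeConjectureFor_biproduct_family₁₃_le₃_of_markmanSixfold
    (hM6 : Markman2025_weilClasses_algebraic_hyperbolicSixfold)
    (h8 : Module.finrank ℚ K = 8) (h2 : Module.finrank ℚ k = 2) (i : k →+* K)
    (hA : ∀ j, IsCMTypeRealisation (Θ j) (A j) (ι j) (θ j)) {τ : k →+* ℂ} (j₁ j₂ j₃ : Fin n)
    (h13 : ∀ j, (Finset.univ.filter fun s : K →+* ℂ => s.comp i = τ ∧ s ∈ (Θ j).1).card = 1)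
    (hpos : ∀ j, Θ j = Θ j₁ ∨ Θ j = Θ j₂ ∨ Θ j = Θ j₃)
    (h2T : ∀ s t s' t' : K →+* ℂ, s.comp i = τ → t.comp i = τ → s'.comp i = τ → t'.comp i = τ → s ≠ t → s' ≠ t' →
      ∃ ρ : ℂ ≃+* ℂ, (ρ : ℂ →+* ℂ).comp s = s' ∧ (ρ : ℂ →+* ℂ).comp t = t')
    (hE : IsCMTypeRealisation Ψ E ιE θE) (hτΨ : τ ∈ Ψ.1) :
    HodgeConjectureFor (⨁ A).dim (⨁ A).X :=
  hodgeConjectureFor_of_avDominatedBy_family₁₃_le₃_of_markmanSixfold hM6 h8 h2 i hA j₁ j₂ j₃ h13 hpos h2T hE hτΨ 0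
    (C := ⨁ A) ⟨AbelianVariety.prodLift 0 (𝟙 _), AbelianVariety.snd _ _, 1, one_ne_zero, by
      rw [AbelianVariety.prodLift_snd, one_smul]⟩

end Family

end Summit.HodgeConjecture.CorCM.OcticWeilMulti

end
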